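import Summits.QuantumFields.BalabanUV.T4Continuum.Support.SkeletonPrecompTools
import Summits.QuantumFields.BalabanUV.T4Continuum.Support.AveragingDeficitTransport
import Literature.Analysis.Complex.RungeUnits
import Literature.MathematicalPhysics.QuantumFieldTheory.Balaban1983to89.B12Membership314
import HarnessLib

/-!
# NE3 support: the flux-gradient dictionary `‖∇_W F‖ ≤ g ⟹ ‖∇_W W(∂p)‖ ≤ 2g`

Cell `pub-balaban-gaps`, seat NE3, census `ne/NE3.md` §4 R39 door (b).  The curved sup-regularity files of the seat
(`Spine/NE3/AxialGaugeDivergence`) consume the kinematic hypothesis «covariant forward gradients of the plaquette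
HOLONOMIES are `≤ x₁`», in both orientations of the plaquette:
`‖Ad_{W(p,μ)} W(∂p_{κν}(p + e_μ)) − W(∂p_{κν}(p))‖ ≤ x₁` (`κ ≠ ν`).  The tree's regularity SHAPE
`MinimalActionRefine.RegularSup` (and the wall's `gradFluxSq`) is phrased with the FLUX `F = log W(∂p)` in the ordered
`Plane` orientation: `‖covGrad W (flux W) x κ π‖ ≤ g`.  This file is the one-line dictionary between the two:

* `Ad_exp_eq` : `Ad_u (e^X) = e^{Ad_u X}` (`B12Membership314.exp_units_conj'`, the `ℂ`-coefficient `exp_units_conj`);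
* `norm_Ad_hol_sub_hol_le_of_fluxGrad` : for unitary `W` in the small-field class of radius `a ≤ 1/4` with
  `‖covGrad W (flux W) z μ π‖ ≤ g` everywhere, `‖Ad_{W(p,μ)} W(∂p_{κν}(p+e_μ)) − W(∂p_{κν}(p))‖ ≤ 2g` for all `κ ≠ ν`
  (`W(∂p) = e^{F(p)}` by `exp_mlog`; `‖F‖ ≤ log 2` by `norm_mlog_le_log_two`; `exp` is `e^{log 2} = 2`-Lipschitz on that
  ball, `Literature.Analysis.Complex.norm_exp_sub_exp_le`; the orientation swap is `SkeletonPrecompTools.norm_covGrad_mlog_le`).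

HONEST: lattice kinematics only; nothing of Bałaban's is asserted; no spine leaf closes here.
-/

open scoped BigOperators Matrix Matrix.Norms.L2Operator
open NormedSpace Finset

namespace Summit.QuantumFields.BalabanUV.T4Continuum.NE3FluxGradientDictionary

open Literature.MathematicalPhysics.QuantumFieldTheory.Balaban1983to89
open B7Prop1Explicit B7Prop2Explicit MatrixLog
open T4AveragingDeficitWall (Ad IsUnitaryCfg SmallField covGrad flux Plane)
open AveragingDeficitTransport (norm_Ad_of_unitary)
open SkeletonPrecompTools (norm_covGrad_mlog_le)

noncomputable section

variable {d : ℕ} {n : Type*} [Fintype n] [DecidableEq n]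

/-- `Ad_u (e^X) = e^{Ad_u X}` (`B12Membership314.exp_units_conj'`). [folklore] -/
theorem Ad_exp_eq (u : (Matrix n n ℂ)ˣ) (X : Matrix n n ℂ) : Ad u (exp X) = exp (Ad u X) := by
  unfold Ad
  exact (B12Membership314.exp_units_conj' u X).symm

/-- **The dictionary**: for a unitary configuration in the small-field class of radius `a ≤ 1/4` whose flux has
covariant forward gradients `≤ g` (ordered planes), the plaquette HOLONOMIES have covariant forward gradients `≤ 2g`
in every orientation `κ ≠ ν`. [folklore] -/
theorem norm_Ad_hol_sub_hol_le_of_fluxGrad {W : Site d → Fin d → (Matrix n n ℂ)ˣ} (hWu : IsUnitaryCfg W) {a g : ℝ}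
    (hs : SmallField W a) (ha : a ≤ 1 / 4) (hg : ∀ (z : Site d) (μ : Fin d) (π : Plane d), ‖covGrad W (flux W) z μ π‖ ≤ g)
    (p : Site d) (μ : Fin d) {κ ν : Fin d} (hκν : κ ≠ ν) :
    ‖Ad (W p μ) ((hol W (p + e μ) (plaqWord κ ν) : (Matrix n n ℂ)ˣ) : Matrix n n ℂ)
        - ((hol W p (plaqWord κ ν) : (Matrix n n ℂ)ˣ) : Matrix n n ℂ)‖ ≤ 2 * g := by
  set H' : Matrix n n ℂ := ((hol W (p + e μ) (plaqWord κ ν) : (Matrix n n ℂ)ˣ) : Matrix n n ℂ) with hH'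
  set H : Matrix n n ℂ := ((hol W p (plaqWord κ ν) : (Matrix n n ℂ)ˣ) : Matrix n n ℂ) with hH
  have hgrad : ‖Ad (W p μ) (mlog H') - mlog H‖ ≤ g := norm_covGrad_mlog_le hs ha hg p μ hκν
  have hg0 : 0 ≤ g := (norm_nonneg _).trans hgrad
  rcases isEmpty_or_nonempty n with hn | hn
  · have h0 : Ad (W p μ) H' - H = 0 := Subsingleton.elim _ _
    rw [h0, norm_zero]; positivity
  have h1' : ‖H' - 1‖ ≤ 1 / 2 := ((hs (p + e μ) κ ν hκν).trans ha).trans (by norm_num)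
  have h1 : ‖H - 1‖ ≤ 1 / 2 := ((hs p κ ν hκν).trans ha).trans (by norm_num)
  have e' : exp (mlog H') = H' := MatrixLog.exp_mlog (h1'.trans_lt (by norm_num))
  have e : exp (mlog H) = H := MatrixLog.exp_mlog (h1.trans_lt (by norm_num))
  have hF' : ‖Ad (W p μ) (mlog H')‖ ≤ Real.log 2 := by
    rw [norm_Ad_of_unitary (hWu p μ)]; exact MatrixLog.norm_mlog_le_log_two h1'
  have hF : ‖mlog H‖ ≤ Real.log 2 := MatrixLog.norm_mlog_le_log_two h1
  calc ‖Ad (W p μ) H' - H‖ = ‖exp (Ad (W p μ) (mlog H')) - exp (mlog H)‖ := by rw [← Ad_exp_eq, e', e]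
    _ ≤ ‖Ad (W p μ) (mlog H') - mlog H‖ * Real.exp (max ‖Ad (W p μ) (mlog H')‖ ‖mlog H‖) :=
        Literature.Analysis.Complex.norm_exp_sub_exp_le _ _
    _ ≤ g * Real.exp (Real.log 2) := by
        gcongr
        exact max_le hF' hF
    _ = 2 * g := by rw [Real.exp_log (by norm_num : (0:ℝ) < 2), mul_comm]

/-- The dictionary in the letters of `MinimalActionRefine.RegularSup`-type data at level `j`: small field of radius
`b/(L^j)^2 ≤ 1/4` and flux gradients `≤ c/(L^j)^3` give holonomy gradients `≤ 2c/(L^j)^3`. [folklore] -/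
theorem norm_Ad_hol_sub_hol_le_of_level {W : Site d → Fin d → (Matrix n n ℂ)ˣ} (hWu : IsUnitaryCfg W) {L j : ℕ}
    {b c : ℝ} (hs : SmallField W (b / ((L : ℝ) ^ j) ^ 2)) (hb : b / ((L : ℝ) ^ j) ^ 2 ≤ 1 / 4)
    (hg : ∀ (z : Site d) (μ : Fin d) (π : Plane d), ‖covGrad W (flux W) z μ π‖ ≤ c / ((L : ℝ) ^ j) ^ 3)
    (p : Site d) (μ : Fin d) {κ ν : Fin d} (hκν : κ ≠ ν) :
    ‖Ad (W p μ) ((hol W (p + e μ) (plaqWord κ ν) : (Matrix n n ℂ)ˣ) : Matrix n n ℂ)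
        - ((hol W p (plaqWord κ ν) : (Matrix n n ℂ)ˣ) : Matrix n n ℂ)‖ ≤ 2 * c / ((L : ℝ) ^ j) ^ 3 := by
  rw [mul_div_assoc]
  exact norm_Ad_hol_sub_hol_le_of_fluxGrad hWu hs hb hg p μ hκν

end

end Summit.QuantumFields.BalabanUV.T4Continuum.NE3FluxGradientDictionary
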